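/-
Copyright (c) 2026 the pub-hodgecm-mathlib formalisation cell (harness21).  Prover seat hodgecm-mathlib-R90-C10-p04 (g2), SLAB R90-TF, section S1 «Ch. 10∕12 local»,
cell «U4-RAM :182 B_pos» (line (D-1) of R90-C10-p05 (g2), L4 dealer K2E3-plan (g5)): brick (B-4), PART 5 «THE SKEW-LINE FIBRE AT THE SHARP LEVEL» for the U4Keys socket
:182 (ramified `χ₁` of positive depth, Branch B) = S1 A2′, crux H413 = `stmt-HodgeConjecture-24833`.  KERNEL module: THEOREMS ONLY (no definition, no named fact, no
`sorry`, no instance, no notation).  2026-09-05.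
-/
import Summits.HodgeConjecture.HodgeConjecture.Theorems.R90S1BposSkewLineFibresDepth   -- ★ (B-4) PART 3 (this seat): (F∼) `skewLineIntegral_eq_of_valued_eq`, (F<₁) `skewLineIntegral_eq_of_valued_lt_one_of_trivial`, `isOpen_setOf_valued_eq_valued`; brings ★ PART 2, ★ PART 1 (§1 `integral_indicator_dite_eq_zero_of_mul_mem_iff`, §2 `integral_indicator_dite_map_ringDecomp_eq_of_prod`) and ★ (II)-b2∕b3a∕b1
import HarnessLib

/-!
# R90 · S1 ∕ U4Keys leaf (U4f-χ₁-ram-one-pos), BRANCH B — brick (B-4), PART 5: THE SKEW-LINE FIBRE `K(a)` AT THE SHARP LEVEL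
# `K(a) := ∫_{y ∈ R⁻, |a + y|_w = 1} χ₁((a + y)^) dμ⁻(y) = −ε₀ · μ⁻{|y|_w < 1}` for a `σ`-fixed `a`, `0 < |a|_w < 1`, when `χ₁` has a depth witness AT level `|a|` and is trivial strictly below
# [Keys1984 §4–§5, §7 Thm (2); WeilBNT1967 Ch. II §5; Roche1998 §3–§4; Rogawski1990 §1.10, §12.2 (2)]

Cell `pub/hodgecm-mathlib` (D-0151), SLAB R90-TF, section S1 «Ch. 10∕12 local», crux H413 = `stmt-HodgeConjecture-24833` (lane `--supports … --as helper`), route of record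
`HCCMUnconditional` (no route verbs); prover seat `hodgecm-mathlib-R90-C10-p04` (g2), hand (B-4) of the B_pos line (D-1) led by R90-C10-p05 (g2) — item (F<₃) of the line lead's
fibre list (R90 bus 2026-09-04T23:29:33Z), consumed by the master integral (B-5) `R90S1BposMasterIntegral` as the letter (K-mid).  THEOREMS ONLY (no `def`, no `instance`, no
notation, no named-fact hypothesis, no `sorry`); ★-only imports (no `Lines` import).  NOT THE PAYER of :182.

FRAME (= ★ (II)-b2∕(II)-b3a v1 spellings; PARTS 1–3 ★): `R := LocalRing L v` at a NON-SPLIT place `v` (`w hw`), `v ∤ 2` (`h2w`), `σ := conjLocal L c v`, `R⁺ = HeisRing.fixedPart σ`,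
`R⁻ = HeisRing.skewPart σ`, `E r := χ₁(r̂)` if `r` is a unit else `0` (inline `dite`), `μ⁻ = μY` a regular additive Haar measure on `R⁻`, `K(a) := ∫ y in {y | |(a + y)_w| = 1}, E(a + y) ∂μY`
for a `σ`-FIXED `a : R`, `ε₀ := χ₁ δ₀` for a skew unit `δ₀` of absolute value one; the Branch-B-inert letter `hfix` «`χ₁ = 1` on the `σ`-fixed units of absolute value one»; the LEVEL
of `a` is `c := Valued.v (a w)`; «`χ₁` trivial STRICTLY below the level» is `htriv : ∀ u, |(u − 1)_w| < c → χ₁ u = 1`; the depth WITNESS sits AT the level: `|(u₀ − 1)_w| ≤ c`, `χ₁ u₀ ≠ 1`.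

* §1 (F<₃) **`skewLineIntegral_eq_of_witness_le_of_trivial_lt`** — AT THE SHARP LEVEL `K(a) = −ε₀ · μ⁻{|y|_w < 1}`.  PROOF: the Borel set `W′ := {b : |(b + σb)_w| ≤ c, |(b − σb)_w| = 1}` —
  in the decomposition `b = a′ + y` exactly `|a′|_w ≤ c ∧ |y|_w = 1` — is `u₀`-INVARIANT (`u₀b ± σ(u₀b) = (b ± σb) + (tb ± σ(tb))`, `|tb ± σ(tb)|_w ≤ |t|_w ≤ c < 1`), so PART 1 §1 + §2
  give `0 = ∫_{|a′| ≤ c} K(a′) dμ⁺(a′)` for the additive Haar measure `μ⁺ := μ⁻ ∘ (δ₀·)⁻¹` of `R⁺` (★ `mulSkewUnit`; its balls and spheres have the `μ⁻`-masses of the same radii since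
  `|δ₀|_w = 1`).  On the sphere `|a′| = c` the fibre is `K(a)` (PART 3 (F∼)); strictly below it is `ε₀·μ⁻(S⁻₁)` (PART 3 (F<₁), `χ₁` trivial there by `htriv`).  Hence
  `0 = μ⁻(S⁻_c)·K(a) + μ⁻(B⁻_{<c})·ε₀·μ⁻(S⁻₁)`; the scaling `y ↦ ây` (★ `HeisRing.smulSkew`, `μ⁻ ∘ (â·)⁻¹ = χ⁻(â)⁻¹·μ⁻` ★ `map_smulSkew_eq`) carries `S⁻₁ ↦ S⁻_c`, `B⁻_{<1} ↦ B⁻_{<c}`, so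
  `μ⁻(S⁻_c) = χ⁻(â)·μ⁻(S⁻₁)` and `μ⁻(B⁻_{<c}) = χ⁻(â)·μ⁻(B⁻_{<1})`, and with `χ⁻(â) > 0` (★ `skewModulus_pos`), `μ⁻(S⁻₁) > 0` (open, `∋ δ₀`): **`K(a) = −ε₀·μ⁻(B⁻_{<1})`** — the SAME value
  as the depth-zero `Φ₁` of ★ (II)-b2 (the sharp level of a depth-zero character is `|a| = 1`).
HONEST LABEL.  HC_CM is proved only modulo the 7 printed citations (2 remaining named inputs: hLiu418 = `stmt-HodgeConjecture-24832`, h413 = `stmt-HodgeConjecture-24833`) until rung 0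
closes; count-neutral — this file does NOT pay :182 (nor :155); no printed citation is discharged; REL ≠ ★ ≠ BUILT.

## References
* [Keys1984] D. Keys, *Principal series representations of special unitary groups over local fields*, Compositio Math. 51 (1984), §4–§5, §7 Theorem (2) p. 126.
* [WeilBNT1967] A. Weil, *Basic Number Theory* (1967), Ch. I §2–§4, Ch. II §5 (Haar measure under homotheties; orthogonality of a non-trivial character of a compact group).
* [Roche1998] A. Roche, *Types and Hecke algebras for principal series representations of split reductive p-adic groups*, Ann. Sci. ÉNS (4) 31 (1998), §3–§4.
* [Rogawski1990] J. D. Rogawski, *Automorphic Representations of Unitary Groups in Three Variables*, Ann. of Math. Stud. 123 (1990), §1.10 p. 9, §12.2 (2) p. 173.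
-/

set_option autoImplicit false
-- the mandated namespace has the single-problem summit's repeated segment (`HodgeConjecture.HodgeConjecture`)
set_option linter.dupNamespace false

noncomputable section

open NumberField IsDedekindDomain MeasureTheory Measure Topology Set
open scoped NNReal ENNReal
open Literature.NumberTheory Literature.NumberTheory.Automorphic Literature.NumberTheory.Automorphic.UnitaryGroup

namespace Summit.HodgeConjecture.HodgeConjecture.R90.S1.BposSkewLineFibreSharpLevel

open Summit.HodgeConjecture.HodgeConjecture.Cruxes.H413
open Summit.HodgeConjecture.HodgeConjecture.Cruxes.H413.K2E3BranchBSkewUnitSign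
open Summit.HodgeConjecture.HodgeConjecture.Cruxes.H413.K2E3BranchBSkewLineIntegrals
open Summit.HodgeConjecture.HodgeConjecture.Cruxes.H413.K2E3BranchBSkewLineCharacterIntegral
open Summit.HodgeConjecture.HodgeConjecture.R90.S1.BposSkewBallCharacterTools
open Summit.HodgeConjecture.HodgeConjecture.R90.S1.BposSkewLineCharacterIntegralDepth
open Summit.HodgeConjecture.HodgeConjecture.R90.S1.BposSkewLineFibresDepth

variable (L : Type) [Field L] [NumberField L] [IsCMField L] (v : HeightOneSpectrum (𝓞 ↥(maximalRealSubfield L)))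
  (w : PlacesOver L v) (hw : IsCMField.complexConj L • w.1 = w.1)

/-! ## §0 The open ball `{|z| < |r|}` of `L_w` -/

omit [IsCMField L] in
/-- The open ball `{z : |z| < |r|}` of `L_w` is open (Mathlib `Valued.isOpen_ball`, through `Valuation.restrict`). [cite: WeilBNT1967, Ch. I §2] -/
theorem isOpen_setOf_valued_lt_valued (r : w.1.adicCompletion L) :
    IsOpen {z : w.1.adicCompletion L | Valued.v z < Valued.v r} := by
  have h : {z : w.1.adicCompletion L | Valued.v z < Valued.v r} =
      {z : w.1.adicCompletion L | (Valued.v : Valuation (w.1.adicCompletion L) _).restrict z <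
        (Valued.v : Valuation (w.1.adicCompletion L) _).restrict r} := by
    ext z
    rw [Set.mem_setOf_eq, Set.mem_setOf_eq, Valuation.restrict_lt_iff]
  rw [h]
  exact Valued.isOpen_ball _ _

/-! ## §1 (F<₃) AT THE SHARP LEVEL: `K(a) = −ε₀ · μ⁻{|y|_w < 1}` -/

section Fibres

variable [MeasurableSpace (LocalRing L v)] [BorelSpace (LocalRing L v)]
  (μY : Measure ↥(HeisRing.skewPart (conjLocal L (IsCMField.complexConj L) v))) [μY.IsAddHaarMeasure] [μY.Regular]

set_option maxHeartbeats 1000000 in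
-- one long tactic block (two invariant-set Fubini splits + the scaling bookkeeping); measured: the default 200000 runs out at `whnf`
open scoped Classical in
include hw in
/-- **(F<₃) — AT THE SHARP LEVEL: `0 < |a|_w < 1`, a unit `u₀` with `|(u₀ − 1)_w| ≤ |a|_w`, `χ₁ u₀ ≠ 1`, and `χ₁` trivial STRICTLY below (`|(u − 1)_w| < |a|_w ⇒ χ₁ u = 1`) ⇒
`K(a) = −ε₀ · μ⁻{|y|_w < 1}`**, `ε₀ = χ₁ δ₀` — the SAME value as the depth-zero `Φ₁` of ★ (II)-b2 p862267 (where the sharp level is `|a| = 1`).  `W′ := {b : |(b + σb)_w| ≤ |a|_w,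
|(b − σb)_w| = 1} = B⁺_{≤|a|} ⊕ S⁻₁` is `u₀`-invariant; PART 1 §1 + §2 give `0 = ∫_{|a′| ≤ |a|} K(a′) dμ⁺ = μ⁺(S⁺_{|a|})·K(a) + μ⁺(B⁺_{<|a|})·ε₀·μ⁻(S⁻₁)` (PART 3 (F∼) on the sphere,
(F<₁) below); `μ⁺ := μ⁻ ∘ (δ₀·)⁻¹` has the `μ⁻`-masses of the same radii, and the scaling `y ↦ ây` turns `μ⁻(B⁻_{<|a|})∕μ⁻(S⁻_{|a|})` into `μ⁻(B⁻_{<1})∕μ⁻(S⁻₁)`.  (The memo's shell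
`m = n − 1`; the lead's (F<₃) ∕ letter (K-mid).) [cite: Keys1984, §4–§5, §7 Theorem (2) p. 126] [cite: WeilBNT1967, Ch. II §5] [cite: Roche1998, §3–§4] -/
theorem skewLineIntegral_eq_of_witness_le_of_trivial_lt (h2w : Valued.v (2 : w.1.adicCompletion L) = 1)
    (χ₁ : (LocalRing L v)ˣ →* ℂˣ) (h₁ : Continuous fun x => ((χ₁ x : ℂˣ) : ℂ))
    (hfix : ∀ u : (LocalRing L v)ˣ, (∀ w' : PlacesOver L v, Valued.v ((u : LocalRing L v) w') = 1) →
      conjLocal L (IsCMField.complexConj L) v (u : LocalRing L v) = u → χ₁ u = 1)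
    (δ₀ : (LocalRing L v)ˣ) (hδσ : conjLocal L (IsCMField.complexConj L) v (δ₀ : LocalRing L v) = -(δ₀ : LocalRing L v)) (hδv : Valued.v ((δ₀ : LocalRing L v) w) = 1)
    {a : LocalRing L v} (ha : conjLocal L (IsCMField.complexConj L) v a = a) (ha0 : Valued.v (a w) ≠ 0) (hav : Valued.v (a w) < 1)
    (u₀ : (LocalRing L v)ˣ) (hu₀ : Valued.v (((u₀ : LocalRing L v) - 1) w) ≤ Valued.v (a w)) (hχ : χ₁ u₀ ≠ 1)
    (htriv : ∀ u : (LocalRing L v)ˣ, Valued.v (((u : LocalRing L v) - 1) w) < Valued.v (a w) → χ₁ u = 1) :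
    ∫ y in {y : ↥(HeisRing.skewPart (conjLocal L (IsCMField.complexConj L) v)) | Valued.v ((a + (y : LocalRing L v)) w) = 1},
        (fun r : LocalRing L v => if h : IsUnit r then ((χ₁ h.unit : ℂˣ) : ℂ) else 0) (a + (y : LocalRing L v)) ∂μY =
      -( ((χ₁ δ₀ : ℂˣ) : ℂ) *
          (μY.real {y : ↥(HeisRing.skewPart (conjLocal L (IsCMField.complexConj L) v)) | Valued.v ((y : LocalRing L v) w) < 1} : ℂ) ) := by
  letI : Invertible (2 : LocalRing L v) := (isUnit_two_localRing L v).invertible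
  haveI : SecondCountableTopology (LocalRing L v) := secondCountableTopology_localRing (E := L) v
  have hσ := conjLocal_conjLocal_cm L v
  have hσc := continuous_conjLocal L (IsCMField.complexConj L) v
  haveI := HeisRing.locallyCompactSpace_fixedPart (conjLocal L (IsCMField.complexConj L) v) hσc
  haveI := HeisRing.locallyCompactSpace_skewPart (conjLocal L (IsCMField.complexConj L) v) hσc
  haveI : SecondCountableTopology ↥(HeisRing.fixedPart (conjLocal L (IsCMField.complexConj L) v)) := TopologicalSpace.Subtype.secondCountableTopology _
  haveI : SecondCountableTopology ↥(HeisRing.skewPart (conjLocal L (IsCMField.complexConj L) v)) := TopologicalSpace.Subtype.secondCountableTopology _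
  -- names
  set E : LocalRing L v → ℂ := fun r : LocalRing L v => if h : IsUnit r then ((χ₁ h.unit : ℂˣ) : ℂ) else 0 with hEdef
  set c := Valued.v (a w) with hcdef
  set ε₀ : ℂ := ((χ₁ δ₀ : ℂˣ) : ℂ) with hε₀def
  set A : Set (LocalRing L v) := {b | Valued.v ((b + conjLocal L (IsCMField.complexConj L) v b) w) ≤ c ∧
    Valued.v ((b - conjLocal L (IsCMField.complexConj L) v b) w) = 1} with hAdef
  set P : Set ↥(HeisRing.fixedPart (conjLocal L (IsCMField.complexConj L) v)) := {a' | Valued.v ((a' : LocalRing L v) w) ≤ c} with hPdef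
  set S : Set ↥(HeisRing.fixedPart (conjLocal L (IsCMField.complexConj L) v)) := {a' | Valued.v ((a' : LocalRing L v) w) = c} with hSdef
  set B : Set ↥(HeisRing.fixedPart (conjLocal L (IsCMField.complexConj L) v)) := {a' | Valued.v ((a' : LocalRing L v) w) < c} with hBdef
  set Y : Set ↥(HeisRing.skewPart (conjLocal L (IsCMField.complexConj L) v)) := {y | Valued.v ((y : LocalRing L v) w) = 1} with hYdef
  set Yc : Set ↥(HeisRing.skewPart (conjLocal L (IsCMField.complexConj L) v)) := {y | Valued.v ((y : LocalRing L v) w) = c} with hYcdef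
  set B₁ : Set ↥(HeisRing.skewPart (conjLocal L (IsCMField.complexConj L) v)) := {y | Valued.v ((y : LocalRing L v) w) < 1} with hB₁def
  set Bc : Set ↥(HeisRing.skewPart (conjLocal L (IsCMField.complexConj L) v)) := {y | Valued.v ((y : LocalRing L v) w) < c} with hBcdef
  set K : ℂ := ∫ y in {y : ↥(HeisRing.skewPart (conjLocal L (IsCMField.complexConj L) v)) | Valued.v ((a + (y : LocalRing L v)) w) = 1},
    E (a + (y : LocalRing L v)) ∂μY with hKdef
  set m₁ : ℂ := (μY.real Y : ℂ) with hm₁def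
  -- valuation bookkeeping
  have hσv : ∀ b : LocalRing L v, Valued.v ((conjLocal L (IsCMField.complexConj L) v b) w) = Valued.v (b w) :=
    fun b => valued_conjLocal_apply_of_smul_eq L v w hw b
  have htwice : ∀ b : LocalRing L v, Valued.v ((b + b) w) = Valued.v (b w) := fun b => by
    rw [Pi.add_apply, ← two_mul, map_mul, h2w, one_mul]
  have hA1 : ∀ b ∈ A, Valued.v (b w) = 1 := fun b hb => by
    refine le_antisymm ?_ ?_
    · have h : Valued.v ((b + b) w) ≤ 1 := by
        rw [show b + b = (b + conjLocal L (IsCMField.complexConj L) v b) + (b - conjLocal L (IsCMField.complexConj L) v b) by ring, Pi.add_apply]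
        exact (Valuation.map_add _ _ _).trans (max_le (hb.1.trans hav.le) hb.2.le)
      rwa [htwice] at h
    · have h : Valued.v ((b - conjLocal L (IsCMField.complexConj L) v b) w) ≤ Valued.v (b w) := by
        rw [Pi.sub_apply]; exact (Valuation.map_sub _ _ _).trans (max_le le_rfl (hσv b).le)
      exact hb.2 ▸ h
  have hunit1 : ∀ u : (LocalRing L v)ˣ, Valued.v (((u : LocalRing L v) - 1) w) ≤ c → Valued.v ((u : LocalRing L v) w) = 1 := fun u hu => by
    have h : (u : LocalRing L v) w = 1 + ((u : LocalRing L v) - 1) w := by rw [Pi.sub_apply, Pi.one_apply, add_sub_cancel]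
    rw [h]; exact Valuation.map_one_add_of_lt _ (lt_of_le_of_lt hu hav)
  have hpert : ∀ (t b : LocalRing L v), Valued.v (t w) ≤ c → Valued.v (b w) = 1 →
      Valued.v ((t * b + conjLocal L (IsCMField.complexConj L) v (t * b)) w) ≤ c ∧ Valued.v ((t * b - conjLocal L (IsCMField.complexConj L) v (t * b)) w) ≤ c := fun t b ht hb => by
    have htb : Valued.v ((t * b) w) ≤ c := by rw [Pi.mul_apply, map_mul, hb, mul_one]; exact ht
    have htb' : Valued.v ((conjLocal L (IsCMField.complexConj L) v (t * b)) w) ≤ c := by rw [hσv]; exact htb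
    exact ⟨by rw [Pi.add_apply]; exact (Valuation.map_add _ _ _).trans (max_le htb htb'),
      by rw [Pi.sub_apply]; exact (Valuation.map_sub _ _ _).trans (max_le htb htb')⟩
  have hstep : ∀ (u : (LocalRing L v)ˣ) (b : LocalRing L v), Valued.v (((u : LocalRing L v) - 1) w) ≤ c → b ∈ A → (u : LocalRing L v) * b ∈ A := fun u b hu hb => by
    obtain ⟨hp, hm⟩ := hpert ((u : LocalRing L v) - 1) b hu (hA1 b hb)
    have hsplitP : (u : LocalRing L v) * b + conjLocal L (IsCMField.complexConj L) v ((u : LocalRing L v) * b) =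
        (b + conjLocal L (IsCMField.complexConj L) v b) +
          (((u : LocalRing L v) - 1) * b + conjLocal L (IsCMField.complexConj L) v (((u : LocalRing L v) - 1) * b)) := by
      rw [show (u : LocalRing L v) * b = b + ((u : LocalRing L v) - 1) * b by ring, map_add]; ring
    have hsplitM : (u : LocalRing L v) * b - conjLocal L (IsCMField.complexConj L) v ((u : LocalRing L v) * b) =
        (b - conjLocal L (IsCMField.complexConj L) v b) +
          (((u : LocalRing L v) - 1) * b - conjLocal L (IsCMField.complexConj L) v (((u : LocalRing L v) - 1) * b)) := by
      rw [show (u : LocalRing L v) * b = b + ((u : LocalRing L v) - 1) * b by ring, map_add]; ring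
    refine ⟨?_, ?_⟩
    · show Valued.v (((u : LocalRing L v) * b + conjLocal L (IsCMField.complexConj L) v ((u : LocalRing L v) * b)) w) ≤ c
      rw [hsplitP, Pi.add_apply]
      exact (Valuation.map_add _ _ _).trans (max_le hb.1 hp)
    · show Valued.v (((u : LocalRing L v) * b - conjLocal L (IsCMField.complexConj L) v ((u : LocalRing L v) * b)) w) = 1
      rw [hsplitM, Pi.add_apply, Valuation.map_add_eq_of_lt_left _ (by rw [hb.2]; exact lt_of_le_of_lt hm hav), hb.2]
  have hu₀inv : Valued.v ((((u₀⁻¹ : (LocalRing L v)ˣ) : LocalRing L v) - 1) w) ≤ c := by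
    have h : (((u₀⁻¹ : (LocalRing L v)ˣ) : LocalRing L v) - 1) w = -((((u₀⁻¹ : (LocalRing L v)ˣ) : LocalRing L v) w) * (((u₀ : LocalRing L v) - 1) w)) := by
      have h1 := units_apply_mul_inv_apply L v u₀ w
      simp only [Pi.sub_apply, Pi.one_apply]
      linear_combination h1
    rw [h, Valuation.map_neg, map_mul, valued_units_inv_apply_eq_one L v (hunit1 _ hu₀), one_mul]; exact hu₀
  -- `A` is Borel and `u₀`-invariant
  have hA : MeasurableSet A := by
    have h : A = (fun b : LocalRing L v => (b + conjLocal L (IsCMField.complexConj L) v b) w) ⁻¹' {z : w.1.adicCompletion L | Valued.v z ≤ Valued.v (a w)} ∩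
        (fun b : LocalRing L v => (b - conjLocal L (IsCMField.complexConj L) v b) w) ⁻¹' {z : w.1.adicCompletion L | Valued.v z = 1} := rfl
    rw [h]
    exact (((isClosed_setOf_valued_le_valued L v w (a w)).preimage ((continuous_apply w).comp (continuous_id.add hσc))).measurableSet).inter
      (((isOpen_setOf_valued_eq_one L v w).preimage ((continuous_apply w).comp (continuous_id.sub hσc))).measurableSet)
  have hAu : ∀ b : LocalRing L v, (u₀ : LocalRing L v) * b ∈ A ↔ b ∈ A := fun b => by
    refine ⟨fun h => ?_, fun h => hstep u₀ b hu₀ h⟩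
    have h' := hstep u₀⁻¹ ((u₀ : LocalRing L v) * b) hu₀inv h
    rwa [← mul_assoc, Units.inv_mul, one_mul] at h'
  have hu₀' : ∀ w' : PlacesOver L v, Valued.v ((u₀ : LocalRing L v) w') = 1 := forall_placesOver_of_apply L v w hw (hunit1 _ hu₀)
  -- the product structure
  have hP1 : P ⊆ {a' | Valued.v ((a' : LocalRing L v) w) ≤ 1} := fun a' ha' => le_trans ha' hav.le
  have hY1 : Y ⊆ {y | Valued.v ((y : LocalRing L v) w) ≤ 1} := fun y hy => le_of_eq hy
  have hAPY : ∀ (a' : ↥(HeisRing.fixedPart (conjLocal L (IsCMField.complexConj L) v))) (y : ↥(HeisRing.skewPart (conjLocal L (IsCMField.complexConj L) v))),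
      (a' : LocalRing L v) + (y : LocalRing L v) ∈ A ↔ a' ∈ P ∧ y ∈ Y := fun a' y => by
    have ha' : conjLocal L (IsCMField.complexConj L) v (a' : LocalRing L v) = a' := (HeisRing.mem_fixedPart_iff _ _).1 a'.2
    have hy : conjLocal L (IsCMField.complexConj L) v (y : LocalRing L v) = -(y : LocalRing L v) := (HeisRing.mem_skewPart_iff _ _).1 y.2
    have hP2 : (a' : LocalRing L v) + (y : LocalRing L v) + conjLocal L (IsCMField.complexConj L) v ((a' : LocalRing L v) + (y : LocalRing L v)) =
        (a' : LocalRing L v) + (a' : LocalRing L v) := by rw [map_add, ha', hy]; ring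
    have hM2 : (a' : LocalRing L v) + (y : LocalRing L v) - conjLocal L (IsCMField.complexConj L) v ((a' : LocalRing L v) + (y : LocalRing L v)) =
        (y : LocalRing L v) + (y : LocalRing L v) := by rw [map_add, ha', hy]; ring
    show (Valued.v (((a' : LocalRing L v) + (y : LocalRing L v) + conjLocal L (IsCMField.complexConj L) v ((a' : LocalRing L v) + (y : LocalRing L v))) w) ≤ c ∧ _) ↔ _
    rw [hP2, hM2, htwice, htwice]
    rfl
  -- `μ⁺ := μ⁻ ∘ (δ₀·)⁻¹` and the Haar measure on `R`
  set eP := HeisRing.mulSkewUnit (conjLocal L (IsCMField.complexConj L) v) δ₀ hδσ with hePdef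
  set μP : Measure ↥(HeisRing.fixedPart (conjLocal L (IsCMField.complexConj L) v)) := μY.map eP.symm with hμPdef
  haveI hμP : μP.IsAddHaarMeasure := ContinuousAddEquiv.isAddHaarMeasure_map μY eP.symm
  haveI : (μP.prod μY).IsAddHaarMeasure := inferInstance
  haveI : ((μP.prod μY).map (HeisRing.ringDecomp (conjLocal L (IsCMField.complexConj L) v) (conjLocal_conjLocal_cm L v) hσc).symm).IsAddHaarMeasure :=
    ContinuousAddEquiv.isAddHaarMeasure_map (μP.prod μY) (HeisRing.ringDecomp (conjLocal L (IsCMField.complexConj L) v) (conjLocal_conjLocal_cm L v) hσc).symm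
  -- PART 1 §1 + §2
  have horth := integral_indicator_dite_eq_zero_of_mul_mem_iff L v w hw
    ((μP.prod μY).map (HeisRing.ringDecomp (conjLocal L (IsCMField.complexConj L) v) (conjLocal_conjLocal_cm L v) hσc).symm) χ₁ h₁ u₀ hu₀' hχ hA hAu
  rw [integral_indicator_dite_map_ringDecomp_eq_of_prod L v w hw χ₁ h₁ μP μY hA hA1 hP1 hY1 hAPY] at horth
  -- the fibres: `K` on the sphere `S` (F∼), `ε₀ · m₁` on the open ball `B` (F<₁)
  have hreg : ∀ a' : ↥(HeisRing.fixedPart (conjLocal L (IsCMField.complexConj L) v)), Valued.v ((a' : LocalRing L v) w) < 1 →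
      {y : ↥(HeisRing.skewPart (conjLocal L (IsCMField.complexConj L) v)) | Valued.v (((a' : LocalRing L v) + (y : LocalRing L v)) w) = 1} = Y := fun a' ha'1 => by
    have ha'fix : conjLocal L (IsCMField.complexConj L) v (a' : LocalRing L v) = a' := (HeisRing.mem_fixedPart_iff _ _).1 a'.2
    ext y
    rw [Set.mem_setOf_eq, valued_add_apply_eq_max L v w hw h2w ha'fix ((HeisRing.mem_skewPart_iff _ _).1 y.2)]
    show max (Valued.v ((a' : LocalRing L v) w)) (Valued.v ((y : LocalRing L v) w)) = 1 ↔ Valued.v ((y : LocalRing L v) w) = 1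
    constructor
    · intro h
      rcases le_total (Valued.v ((a' : LocalRing L v) w)) (Valued.v ((y : LocalRing L v) w)) with hle | hle
      · rwa [max_eq_right hle] at h
      · rw [max_eq_left hle] at h; exact absurd h ha'1.ne
    · intro h; rw [h]; exact max_eq_right ha'1.le
  have hfib : ∀ a' : ↥(HeisRing.fixedPart (conjLocal L (IsCMField.complexConj L) v)),
      P.indicator (fun a'' => ∫ y in Y, E ((a'' : LocalRing L v) + (y : LocalRing L v)) ∂μY) a' =
        S.indicator (fun _ => K) a' + B.indicator (fun _ => ε₀ * m₁) a' := fun a' => by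
    have ha'fix : conjLocal L (IsCMField.complexConj L) v (a' : LocalRing L v) = a' := (HeisRing.mem_fixedPart_iff _ _).1 a'.2
    rcases lt_trichotomy (Valued.v ((a' : LocalRing L v) w)) c with hlt | heq | hgt
    · -- strictly below the level: (F<₁) with `χ₁` trivial at level `|a′|`
      rw [Set.indicator_of_mem (show a' ∈ P from hlt.le), Set.indicator_of_notMem (show a' ∉ S from hlt.ne), Set.indicator_of_mem (show a' ∈ B from hlt), zero_add,
        ← hreg a' (lt_trans hlt hav)]
      exact skewLineIntegral_eq_of_valued_lt_one_of_trivial L v w hw μY h2w χ₁ hfix δ₀ hδσ hδv ha'fix (lt_trans hlt hav)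
        (fun u hu => htriv u (lt_of_le_of_lt hu hlt))
    · -- on the sphere: (F∼)
      rw [Set.indicator_of_mem (show a' ∈ P from heq.le), Set.indicator_of_mem (show a' ∈ S from heq), Set.indicator_of_notMem (show a' ∉ B from fun h => h.ne heq),
        add_zero, ← hreg a' (heq ▸ hav)]
      exact skewLineIntegral_eq_of_valued_eq L v w hw μY χ₁ hfix ha ha'fix ha0 heq
    · rw [Set.indicator_of_notMem (show a' ∉ P from fun h => absurd h hgt.not_ge), Set.indicator_of_notMem (show a' ∉ S from hgt.ne'),
        Set.indicator_of_notMem (show a' ∉ B from fun h => lt_asymm h hgt), add_zero]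
  -- the `μ⁺`-masses of `S` and `B`
  have hcoe : ∀ y : ↥(HeisRing.skewPart (conjLocal L (IsCMField.complexConj L) v)),
      ((eP.symm y : ↥(HeisRing.fixedPart (conjLocal L (IsCMField.complexConj L) v))) : LocalRing L v) =
        ((δ₀⁻¹ : (LocalRing L v)ˣ) : LocalRing L v) * (y : LocalRing L v) := fun y => rfl
  have hδinv : Valued.v (((δ₀⁻¹ : (LocalRing L v)ˣ) : LocalRing L v) w) = 1 := valued_units_inv_apply_eq_one L v hδv
  have hpre : ∀ (Q : _ → Prop), eP.symm ⁻¹' {a' : ↥(HeisRing.fixedPart (conjLocal L (IsCMField.complexConj L) v)) | Q (Valued.v ((a' : LocalRing L v) w))} =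
      {y : ↥(HeisRing.skewPart (conjLocal L (IsCMField.complexConj L) v)) | Q (Valued.v ((y : LocalRing L v) w))} := by
    intro Q
    ext y
    simp only [Set.mem_preimage, Set.mem_setOf_eq, hcoe, Pi.mul_apply, Valuation.map_mul, hδinv, one_mul]
  have hmeasE : Measurable (⇑eP.symm) := eP.symm.continuous.measurable
  have hSR : MeasurableSet {r : LocalRing L v | Valued.v (r w) = c} := by
    have h : {r : LocalRing L v | Valued.v (r w) = c} = (fun r : LocalRing L v => r w) ⁻¹' {z : w.1.adicCompletion L | Valued.v z = Valued.v (a w)} := rfl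
    rw [h]; exact ((isOpen_setOf_valued_eq_valued L v w ha0).preimage (continuous_apply w)).measurableSet
  have hBR : MeasurableSet {r : LocalRing L v | Valued.v (r w) < c} := by
    have h : {r : LocalRing L v | Valued.v (r w) < c} = (fun r : LocalRing L v => r w) ⁻¹' {z : w.1.adicCompletion L | Valued.v z < Valued.v (a w)} := rfl
    rw [h]; exact ((isOpen_setOf_valued_lt_valued L v w (a w)).preimage (continuous_apply w)).measurableSet
  have hSm : MeasurableSet S := measurable_subtype_coe hSR
  have hBm : MeasurableSet B := measurable_subtype_coe hBR
  have hYcm : MeasurableSet Yc := measurable_subtype_coe hSR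
  have hBcm : MeasurableSet Bc := measurable_subtype_coe hBR
  have hrealS : μP.real S = μY.real Yc := by
    rw [measureReal_def, measureReal_def, hμPdef, Measure.map_apply hmeasE hSm, hpre (fun t => t = c)]
  have hrealB : μP.real B = μY.real Bc := by
    rw [measureReal_def, measureReal_def, hμPdef, Measure.map_apply hmeasE hBm, hpre (fun t => t < c)]
  -- finiteness of the two `μ⁺`-masses (inside the compact unit ball)
  have hBPc : IsCompact {a' : ↥(HeisRing.fixedPart (conjLocal L (IsCMField.complexConj L) v)) | Valued.v ((a' : LocalRing L v) w) ≤ 1} :=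
    (HeisRing.isClosed_fixedPart _ hσc).isClosedEmbedding_subtypeVal.isCompact_preimage (isCompact_setOf_valued_apply_le_one L v w hw)
  have hSfin : μP S ≠ ⊤ :=
    ((measure_mono (fun a' (ha' : a' ∈ S) => hP1 (show Valued.v ((a' : LocalRing L v) w) ≤ c from le_of_eq ha'))).trans_lt hBPc.measure_lt_top).ne
  have hBfin : μP B ≠ ⊤ :=
    ((measure_mono (fun a' (ha' : a' ∈ B) => hP1 (show Valued.v ((a' : LocalRing L v) w) ≤ c from le_of_lt ha'))).trans_lt hBPc.measure_lt_top).ne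
  have hIS : Integrable (S.indicator (fun _ => K)) μP := (integrableOn_const (hs := hSfin)).integrable_indicator hSm
  have hIB : Integrable (B.indicator (fun _ => ε₀ * m₁)) μP := (integrableOn_const (hs := hBfin)).integrable_indicator hBm
  rw [integral_congr_ae (Filter.Eventually.of_forall hfib), integral_add hIS hIB, integral_indicator_const K hSm, integral_indicator_const _ hBm,
    Complex.real_smul, Complex.real_smul, hrealS, hrealB] at horth
  -- the scaling `y ↦ â y`: `μ⁻(S⁻_c) = χ⁻(â)·μ⁻(S⁻₁)`, `μ⁻(B⁻_{<c}) = χ⁻(â)·μ⁻(B⁻_{<1})`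
  have haU : IsUnit a := K2E3DepthZeroIwahoriCharacterCM.isUnit_of_apply_ne_zero L v w hw a (fun h => ha0 (by rw [hcdef, h, map_zero]))
  have hâfix : conjLocal L (IsCMField.complexConj L) v (haU.unit : LocalRing L v) = haU.unit := by rw [haU.unit_spec]; exact ha
  have hâv : Valued.v ((haU.unit : LocalRing L v) w) = c := by rw [haU.unit_spec]
  set T := HeisRing.smulSkew (conjLocal L (IsCMField.complexConj L) v) haU.unit hâfix with hT
  set κ : ℝ≥0 := HeisRing.skewModulus (conjLocal L (IsCMField.complexConj L) v) hσc haU.unit hâfix with hκdef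
  have hκpos : 0 < κ := HeisRing.skewModulus_pos (conjLocal L (IsCMField.complexConj L) v) hσc haU.unit hâfix
  have hmapT : μY.map T = (κ⁻¹ : ℝ≥0) • μY := HeisRing.map_smulSkew_eq (conjLocal L (IsCMField.complexConj L) v) hσc haU.unit hâfix μY
  have hc0 : (0 : WithZero (Multiplicative ℤ)) < c := lt_of_le_of_ne _root_.zero_le (Ne.symm ha0)
  have hTpreS : T ⁻¹' Yc = Y := by
    ext y
    rw [Set.mem_preimage, hYcdef, hYdef, Set.mem_setOf_eq, Set.mem_setOf_eq, hT, HeisRing.coe_smulSkew, Pi.mul_apply, map_mul, hâv]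
    exact mul_eq_left₀ ha0
  have hTpreB : T ⁻¹' Bc = B₁ := by
    ext y
    rw [Set.mem_preimage, hBcdef, hB₁def, Set.mem_setOf_eq, Set.mem_setOf_eq, hT, HeisRing.coe_smulSkew, Pi.mul_apply, map_mul, hâv]
    conv_lhs => rw [show c = c * 1 from (mul_one c).symm, mul_assoc, one_mul]
    exact mul_lt_mul_iff_right₀ hc0
  have hmeasT : Measurable T := T.continuous.measurable
  have hscaleS : μY Y = (κ⁻¹ : ℝ≥0) * μY Yc := by
    rw [← hTpreS, ← Measure.map_apply hmeasT hYcm, hmapT, Measure.coe_nnreal_smul_apply]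
  have hscaleB : μY B₁ = (κ⁻¹ : ℝ≥0) * μY Bc := by
    rw [← hTpreB, ← Measure.map_apply hmeasT hBcm, hmapT, Measure.coe_nnreal_smul_apply]
  have hκne : ((κ : ℝ≥0) : ℝ≥0∞) ≠ 0 := by exact_mod_cast hκpos.ne'
  have hrealYc : μY.real Yc = (κ : ℝ) * μY.real Y := by
    rw [measureReal_def, measureReal_def, hscaleS, ENNReal.toReal_mul, ← mul_assoc, ENNReal.coe_inv hκpos.ne', ENNReal.toReal_inv,
      ENNReal.coe_toReal, mul_inv_cancel₀ (NNReal.coe_ne_zero.2 hκpos.ne'), one_mul]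
  have hrealBc : μY.real Bc = (κ : ℝ) * μY.real B₁ := by
    rw [measureReal_def, measureReal_def, hscaleB, ENNReal.toReal_mul, ← mul_assoc, ENNReal.coe_inv hκpos.ne', ENNReal.toReal_inv,
      ENNReal.coe_toReal, mul_inv_cancel₀ (NNReal.coe_ne_zero.2 hκpos.ne'), one_mul]
  rw [hrealYc, hrealBc] at horth
  -- `μ⁻(S⁻₁) > 0` (open, `∋ δ₀`, inside the compact unit ball)
  have hsph : IsOpen Y := by
    have h : Y = (fun y : ↥(HeisRing.skewPart (conjLocal L (IsCMField.complexConj L) v)) => (y : LocalRing L v) w) ⁻¹' {z : w.1.adicCompletion L | Valued.v z = 1} := rfl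
    rw [h]; exact (isOpen_setOf_valued_eq_one L v w).preimage ((continuous_apply w).comp continuous_subtype_val)
  have hne : Y.Nonempty := ⟨⟨(δ₀ : LocalRing L v), (HeisRing.mem_skewPart_iff _ _).2 hδσ⟩, hδv⟩
  have hfin : μY Y ≠ ⊤ := by
    have hBYc : IsCompact {y : ↥(HeisRing.skewPart (conjLocal L (IsCMField.complexConj L) v)) | Valued.v ((y : LocalRing L v) w) ≤ 1} :=
      (HeisRing.isClosed_skewPart _ hσc).isClosedEmbedding_subtypeVal.isCompact_preimage (isCompact_setOf_valued_apply_le_one L v w hw)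
    exact ((measure_mono hY1).trans_lt hBYc.measure_lt_top).ne
  have hm1 : m₁ ≠ 0 := by
    rw [hm₁def, Ne, Complex.ofReal_eq_zero, measureReal_def, ENNReal.toReal_eq_zero_iff, not_or]
    exact ⟨(hsph.measure_pos μY hne).ne', hfin⟩
  have hκC : ((κ : ℝ) : ℂ) ≠ 0 := by exact_mod_cast hκpos.ne'
  -- the algebra: `0 = κ·m₁·K + κ·m_{B₁}·ε₀·m₁`
  have h0 : ((κ : ℝ) : ℂ) * m₁ * (K + ε₀ * (μY.real B₁ : ℂ)) = 0 := by
    rw [Complex.ofReal_mul, Complex.ofReal_mul] at horth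
    linear_combination horth
  have hK : K + ε₀ * (μY.real B₁ : ℂ) = 0 := (mul_eq_zero.1 h0).resolve_left (mul_ne_zero hκC hm1)
  exact eq_neg_of_add_eq_zero_left hK

end Fibres

end Summit.HodgeConjecture.HodgeConjecture.R90.S1.BposSkewLineFibreSharpLevel

end
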